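import Summits.AnomalousDissipation.AnomalousDissipation.Theorems.SolenoidalFractalHomogenisationRealisedQuasiStaticCellLawCellSlotFormulas
import HarnessLib

/-!
# K2R `RealisedQuasiStaticCellLaw`, line `floquet-bloch`, stub `stub_lowSectorDecay` (S1D): the per-slot nominal exponent
# `Λ_jτ_j g₁,j²` in closed form (both weak roads' rate arithmetic)

Summits-side helper file (everything proved; no definitions, no named facts; `--supports stmt-AnomalousDissipation-20446`).
For any word, cell `n`, viscosity `κ`: with `Λ_j = κ4π²|K_j|²` and the peak coupling `g₁,j = 2πθ_j|a_j|/(nΛ_j)` of the road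
files, `Λ_jτ_j·g₁,j² = τ_jθ_j²/(16π²κn⁴‖m_j‖⁴)` (`slot_exponent_formula`) — i.e. `(2π²/(κn⁴))·[τ_jθ_j²/(32π⁴|m_j|⁴)]`, the
bracket being the `slotGain` weight; this is how the sums of nominal slow exponents reduce to `slotTerm_sum` /
`isotropicWordGain_cubatureWord` / `minPol_slotTerm_sum`.
-/

set_option linter.dupNamespace false

noncomputable section

namespace Summit.AnomalousDissipation.AnomalousDissipation.Theorems.SolenoidalFractalHomogenisation.RealisedQuasiStaticCellLaw

open Complex
open Literature.Analysis Literature.Analysis.FunctionSpaces Literature.Analysis.FunctionSpaces.Torus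
open Literature.Analysis.FluidPDE Literature.Analysis.FluidPDE.LatticeShear

/-- **The nominal slow exponent of a slot in closed form.** -/
theorem slot_exponent_formula (P : LatticePhase) {n : ℕ} (hn : 0 < n) {κ : ℝ} (hκ : 0 < κ) (θ τ : ℝ) :
    κ * (4 * Real.pi ^ 2 * freqNormSq (fun i => P.m i * (n : ℤ))) * τ *
        (2 * Real.pi * θ *
            ‖Complex.exp (P.φ * Complex.I) * (1 / (2 * ((2 * Real.pi * ‖latticeVec P.m‖ : ℝ) : ℂ) * Complex.I))‖ *
            (1 / (n : ℝ)) / (κ * (4 * Real.pi ^ 2 * freqNormSq (fun i => P.m i * (n : ℤ))))) ^ 2 =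
      τ * θ ^ 2 / (16 * Real.pi ^ 2 * κ * (n : ℝ) ^ 4 * ‖latticeVec P.m‖ ^ 4) := by
  have hn' : (0 : ℝ) < n := by exact_mod_cast hn
  have hm : 0 < ‖latticeVec P.m‖ := lt_of_lt_of_le one_pos (one_le_norm_latticeVec P.m_ne)
  rw [norm_layerAmp P, freqNormSq_cellFreq, ← norm_latticeVec_sq]
  field_simp
  ring

/-- The same against the `slotGain` weight: `Λτg₁² = (2π²/(κn⁴))·(τθ²/(2(2π|m|)⁴))`. -/
theorem slot_exponent_eq_slotWeight (P : LatticePhase) {n : ℕ} (hn : 0 < n) {κ : ℝ} (hκ : 0 < κ) (θ τ : ℝ) :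
    κ * (4 * Real.pi ^ 2 * freqNormSq (fun i => P.m i * (n : ℤ))) * τ *
        (2 * Real.pi * θ *
            ‖Complex.exp (P.φ * Complex.I) * (1 / (2 * ((2 * Real.pi * ‖latticeVec P.m‖ : ℝ) : ℂ) * Complex.I))‖ *
            (1 / (n : ℝ)) / (κ * (4 * Real.pi ^ 2 * freqNormSq (fun i => P.m i * (n : ℤ))))) ^ 2 =
      2 * Real.pi ^ 2 / (κ * (n : ℝ) ^ 4) * (τ * (1 / (2 * (2 * Real.pi * ‖latticeVec P.m‖) ^ 4)) * θ ^ 2) := by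
  rw [slot_exponent_formula P hn hκ]
  have hn' : (0 : ℝ) < n := by exact_mod_cast hn
  have hm : 0 < ‖latticeVec P.m‖ := lt_of_lt_of_le one_pos (one_le_norm_latticeVec P.m_ne)
  field_simp
  ring

end Summit.AnomalousDissipation.AnomalousDissipation.Theorems.SolenoidalFractalHomogenisation.RealisedQuasiStaticCellLaw

end
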